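import Summits.AtomisticToContinuum.BoseEinsteinCondensation.Theses.BECHardSphereReduction
import Literature.MathematicalPhysics.QuantumManyBody.BoseGasThermodynamicLimitProofs
import HarnessLib

/-!
# Crux `HardSphereBEC` (stmt-AtomisticToContinuum-11885), line `registered` — reductions of the
# stub `stub_densityMonotone`

Route `BECHardSphereReduction`, skeleton `Cruxes/HardSphereBEC/Lines/birth.lean` (sha c763a27be332).
The registered stub `stub_densityMonotone` ("dilution never destroys hard-sphere BEC") reads

  `∃ η₀ > 0, ∀ η η', 0 < η' → η' ≤ η → η ≤ η₀ → HasGroundStateBEC HS₁ η → HasGroundStateBEC HS₁ η'`,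

`HS₁ = Set.indicator (Set.Iic 1) ⊤` the unit-diameter hard-sphere pair potential.  This file records,
kernel-checked, where the stub sits relative to the route's existing items (pure logic over the
route file plus three lines of real arithmetic about `L_N(η) = (N/η)^{1/3}`):

* `densityMonotone_of_eventually_condensateNumber_le` — what the stub actually consumes: a
  THERMODYNAMIC TRACE of box monotonicity, i.e. for `0 < η' ≤ η ≤ η₀`, eventually in `N`,
  `condensateNumber HS₁ N (L_N η) ≤ condensateNumber HS₁ N (L_N η')` (same constant `c`,
  `Filter.Eventually.mono`); and the version losing a constant factor,
  `densityMonotone_of_eventually_condensateNumber_le_mul`;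
* `eventually_condensateNumber_le_of_hardSphereBoxMonotone` — the route's crux #4
  `HardSphereBoxMonotone` (stmt-11886: `∃ η₀ > 0, ∀ N L₁ L₂, N ≤ η₀ L₁³ → L₁ ≤ L₂ →
  cn(HS₁,N,L₁) ≤ cn(HS₁,N,L₂)`) gives that trace for every `N` (not only eventually): along
  `L₁ := L_N(η) ≤ L_N(η') =: L₂` (`sideLength_le_sideLength`, `ρ ↦ (N/ρ)^{1/3}` is antitone) the
  dilute guard `N ≤ η₀ L_N(η)³` is `η ≤ η₀` because `L_N(η)³ = N/η` (`sideLength_pow_three`);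
* `densityMonotone_of_hardSphereBoxMonotone` — hence `HardSphereBoxMonotone →` stub signature
  (verbatim);
* `densityMonotone_of_hardSphereBEC` — independently, the crux itself gives the stub (take `a := 1`,
  `η₀ := ρ₀(1)/2`; the BEC hypothesis at `η` is not even used), so the stub cannot be refuted
  without refuting the crux.

## What was checked towards an UNCONDITIONAL proof of the stub (none found; 2026-08-17)

1. No choice of `η₀` makes it vacuous: for every `η₀ > 0` the instance `η := η₀`, `η' ∈ (0, η₀]`
   arbitrary is included, and `HasGroundStateBEC HS₁ η₀` for small `η₀` is LSSY's open problem in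
   the model case (expected TRUE: Bogoliubov condensate fraction `1 - 1.5045√η`), so neither
   `¬ hypothesis` nor `conclusion` is provable.  (For `η₀` beyond close packing `E₀ = ⊤` eventually
   and the hypothesis fails, but small `η` stay in range.)
2. No order-theoretic shortcut inside `condensateNumber`: the two sides live on DIFFERENT boxes
   `L_N(η) < L_N(η')`; zero-extension `TrialState.enlarge` maps `TrialState N (L_N η)` into
   `TrialState N (L_N η')` and gives `E₀(N, L_N η') ≤ E₀(N, L_N η)` (`groundStateEnergy_anti`), but a
   near-minimiser of the small box is NOT a near-minimiser of the big one (`E₀` strictly decreases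
   in `L`), so the `⨅` over near-minimisers is not comparable for free; `maxOccupation ≤ N`
   (Cauchy–Schwarz) only bounds the wrong side.
3. Scaling does not help either: by `HardSphereScaling` (11887, proved)
   `cn(HS₁, N, s·L) = cn(HS_{1/s}, N, L)`, `s := (η/η')^{1/3} ≥ 1`, so the stub for ONE pair
   `(η, η')` is the instance `v := HS_{1/s}`, `R := 1` of the crux `HardCoreDominates` (stmt-11884)
   along `L = L_N(η)` — but its guard is `η ≤ η₀(HS_{1/s})` with a threshold depending on the ratio
   `η/η'`, which is unbounded; 11884 therefore yields only the skeleton `BEC(η) → BEC(η/r^k)` for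
   each fixed ratio `r` (e.g. dyadic), never all `η' ∈ (0, η]`.  Uniformity of the threshold over
   the compact family `{HS_t : 2^{-1/3} ≤ t ≤ 1}` is, by the same scaling and chaining, exactly
   `HardSphereBoxMonotone` (11886).  So 11886 is the one existing item that yields the stub.
4. Not false, not mis-stated: implied by the crux (`densityMonotone_of_hardSphereBEC`), and it is
   literally the second hypothesis of the registered composition `HardSphereBEC_of_sigs`.
-/

noncomputable section

namespace Summit.AtomisticToContinuum.BoseEinsteinCondensation.Cruxes.HardSphereBEC

open MeasureTheory ENNReal Filter Literature.MathematicalPhysics.QuantumManyBody.BoseGas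
open Summit.AtomisticToContinuum.BoseEinsteinCondensation.Theses.BECHardSphereReduction

/-! ## Real arithmetic of the thermodynamic side length -/

/-- `L_N(η)³ = N/η` for `η > 0` (all `N`, including `N = 0` where both sides vanish). [folklore] -/
theorem sideLength_pow_three {η : ℝ} (hη : 0 < η) (N : ℕ) :
    sideLength η N ^ 3 = (N : ℝ) / η := by
  rw [sideLength, ← Real.rpow_natCast, ← Real.rpow_mul (div_nonneg N.cast_nonneg hη.le)]
  norm_num

/-- The dilute guard of `HardSphereBoxMonotone` along the thermodynamic sequence:
`N ≤ η₀ · L_N(η)³` as soon as `η ≤ η₀` (it is `η · (N/η) ≤ η₀ · (N/η)`). [folklore] -/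
theorem natCast_le_mul_sideLength_pow_three {η η₀ : ℝ} (hη : 0 < η) (h : η ≤ η₀) (N : ℕ) :
    (N : ℝ) ≤ η₀ * sideLength η N ^ 3 := by
  rw [sideLength_pow_three hη]
  have hN : (0 : ℝ) ≤ N / η := div_nonneg N.cast_nonneg hη.le
  calc (N : ℝ) = η * (N / η) := by field_simp
    _ ≤ η₀ * (N / η) := mul_le_mul_of_nonneg_right h hN

/-! ## What the stub consumes: a thermodynamic trace of box monotonicity -/

/-- **Thermodynamic box monotonicity gives the stub.**  If below some reduced density `η₀` the
condensate number of `N` unit hard spheres in the box of side `L_N(η)` is, eventually in `N`, at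
most that in the larger box of side `L_N(η')` (`0 < η' ≤ η ≤ η₀`), then ground-state BEC at `η`
(constant `c`) gives ground-state BEC at `η'` with the same constant. [folklore] -/
theorem densityMonotone_of_eventually_condensateNumber_le
    (h : ∃ η₀ : ℝ, 0 < η₀ ∧ ∀ η η' : ℝ, 0 < η' → η' ≤ η → η ≤ η₀ → ∀ᶠ N : ℕ in atTop,
      condensateNumber (Set.indicator (Set.Iic 1) (fun _ : ℝ => (⊤ : ENNReal))) N (sideLength η N) ≤
        condensateNumber (Set.indicator (Set.Iic 1) (fun _ : ℝ => (⊤ : ENNReal))) N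
          (sideLength η' N)) :
    ∃ η₀ : ℝ, 0 < η₀ ∧ ∀ η η' : ℝ, 0 < η' → η' ≤ η → η ≤ η₀ →
      Literature.MathematicalPhysics.QuantumManyBody.BoseGas.HasGroundStateBEC
        (Set.indicator (Set.Iic 1) (fun _ : ℝ => (⊤ : ENNReal))) η →
      Literature.MathematicalPhysics.QuantumManyBody.BoseGas.HasGroundStateBEC
        (Set.indicator (Set.Iic 1) (fun _ : ℝ => (⊤ : ENNReal))) η' := by
  obtain ⟨η₀, hη₀, hmono⟩ := h
  refine ⟨η₀, hη₀, fun η η' hη' hle hη₀le hBEC => ?_⟩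
  obtain ⟨c, hc, hev⟩ := hBEC
  exact ⟨c, hc, (hev.and (hmono η η' hη' hle hη₀le)).mono fun N hN => hN.1.trans hN.2⟩

/-- **Comparability up to a constant factor suffices.**  If for `0 < η' ≤ η ≤ η₀` there is
`K > 0` with `cn(HS₁, N, L_N η) ≤ K · cn(HS₁, N, L_N η')` eventually in `N`, then BEC at `η` with
constant `c` gives BEC at `η'` with constant `c / K`. [folklore] -/
theorem densityMonotone_of_eventually_condensateNumber_le_mul
    (h : ∃ η₀ : ℝ, 0 < η₀ ∧ ∀ η η' : ℝ, 0 < η' → η' ≤ η → η ≤ η₀ → ∃ K : ℝ, 0 < K ∧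
      ∀ᶠ N : ℕ in atTop,
        condensateNumber (Set.indicator (Set.Iic 1) (fun _ : ℝ => (⊤ : ENNReal))) N
            (sideLength η N) ≤
          ENNReal.ofReal K *
            condensateNumber (Set.indicator (Set.Iic 1) (fun _ : ℝ => (⊤ : ENNReal))) N
              (sideLength η' N)) :
    ∃ η₀ : ℝ, 0 < η₀ ∧ ∀ η η' : ℝ, 0 < η' → η' ≤ η → η ≤ η₀ →
      Literature.MathematicalPhysics.QuantumManyBody.BoseGas.HasGroundStateBEC
        (Set.indicator (Set.Iic 1) (fun _ : ℝ => (⊤ : ENNReal))) η →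
      Literature.MathematicalPhysics.QuantumManyBody.BoseGas.HasGroundStateBEC
        (Set.indicator (Set.Iic 1) (fun _ : ℝ => (⊤ : ENNReal))) η' := by
  obtain ⟨η₀, hη₀, hmono⟩ := h
  refine ⟨η₀, hη₀, fun η η' hη' hle hη₀le hBEC => ?_⟩
  obtain ⟨c, hc, hev⟩ := hBEC
  obtain ⟨K, hK, hevK⟩ := hmono η η' hη' hle hη₀le
  refine ⟨c / K, div_pos hc hK, ?_⟩
  filter_upwards [hev, hevK] with N hN hNK
  have hcast : c / K * (N : ℝ) = c * N / K := by ring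
  rw [hcast, ENNReal.ofReal_div_of_pos hK]
  exact ENNReal.div_le_of_le_mul' (hN.trans hNK)

/-! ## The route's crux #4 `HardSphereBoxMonotone` (stmt-11886) gives the stub -/

/-- **`HardSphereBoxMonotone` along the thermodynamic sequence.**  With the threshold `η₀` of
stmt-11886, for `0 < η' ≤ η ≤ η₀` and EVERY `N` one has
`cn(HS₁, N, L_N η) ≤ cn(HS₁, N, L_N η')`: the boxes are ordered, `L_N(η) ≤ L_N(η')`
(`sideLength_le_sideLength`), and the dilute guard `N ≤ η₀ L_N(η)³` is `η ≤ η₀`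
(`natCast_le_mul_sideLength_pow_three`). [folklore] -/
theorem condensateNumber_sideLength_le_of_hardSphereBoxMonotone (h : HardSphereBoxMonotone) :
    ∃ η₀ : ℝ, 0 < η₀ ∧ ∀ η η' : ℝ, 0 < η' → η' ≤ η → η ≤ η₀ → ∀ N : ℕ,
      condensateNumber (Set.indicator (Set.Iic 1) (fun _ : ℝ => (⊤ : ENNReal))) N (sideLength η N) ≤
        condensateNumber (Set.indicator (Set.Iic 1) (fun _ : ℝ => (⊤ : ENNReal))) N
          (sideLength η' N) := by
  obtain ⟨η₀, hη₀, hmono⟩ := h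
  refine ⟨η₀, hη₀, fun η η' hη' hle hη₀le N => ?_⟩
  have hη : 0 < η := hη'.trans_le hle
  exact hmono N _ _ (natCast_le_mul_sideLength_pow_three hη hη₀le N)
    (sideLength_le_sideLength hη' hle N)

/-- The eventual (thermodynamic-trace) form of the previous lemma, the hypothesis of
`densityMonotone_of_eventually_condensateNumber_le`. [folklore] -/
theorem eventually_condensateNumber_le_of_hardSphereBoxMonotone (h : HardSphereBoxMonotone) :
    ∃ η₀ : ℝ, 0 < η₀ ∧ ∀ η η' : ℝ, 0 < η' → η' ≤ η → η ≤ η₀ → ∀ᶠ N : ℕ in atTop,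
      condensateNumber (Set.indicator (Set.Iic 1) (fun _ : ℝ => (⊤ : ENNReal))) N (sideLength η N) ≤
        condensateNumber (Set.indicator (Set.Iic 1) (fun _ : ℝ => (⊤ : ENNReal))) N
          (sideLength η' N) := by
  obtain ⟨η₀, hη₀, hmono⟩ := condensateNumber_sideLength_le_of_hardSphereBoxMonotone h
  exact ⟨η₀, hη₀, fun η η' hη' hle hη₀le =>
    Filter.Eventually.of_forall (hmono η η' hη' hle hη₀le)⟩

/-- **`HardSphereBoxMonotone` (stmt-11886) implies the stub `stub_densityMonotone`** (signature
verbatim): diluting never lowers the condensate number of `N` unit hard spheres once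
`N ≤ η₀ L³`, so along `L_N(η) ≤ L_N(η')` BEC at `η ≤ η₀` propagates to every `η' ∈ (0, η]` with the
same constant. [folklore] -/
theorem densityMonotone_of_hardSphereBoxMonotone (h : HardSphereBoxMonotone) :
    ∃ η₀ : ℝ, 0 < η₀ ∧ ∀ η η' : ℝ, 0 < η' → η' ≤ η → η ≤ η₀ →
      Literature.MathematicalPhysics.QuantumManyBody.BoseGas.HasGroundStateBEC
        (Set.indicator (Set.Iic 1) (fun _ : ℝ => (⊤ : ENNReal))) η →
      Literature.MathematicalPhysics.QuantumManyBody.BoseGas.HasGroundStateBEC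
        (Set.indicator (Set.Iic 1) (fun _ : ℝ => (⊤ : ENNReal))) η' :=
  densityMonotone_of_eventually_condensateNumber_le
    (eventually_condensateNumber_le_of_hardSphereBoxMonotone h)

/-! ## The crux itself gives the stub -/

/-- **`HardSphereBEC` (the crux, stmt-11885) implies the stub `stub_densityMonotone`** (signature
verbatim), by pure logic: with `ρ₀ := ρ₀(1)` from the crux at diameter `a := 1` take
`η₀ := ρ₀ / 2`; then every `η' ≤ η ≤ η₀` has `η' < ρ₀`, so BEC at `η'` holds outright and the BEC
hypothesis at `η` is not used.  Hence the stub cannot be refuted without refuting the crux.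
[folklore] -/
theorem densityMonotone_of_hardSphereBEC (h : HardSphereBEC) :
    ∃ η₀ : ℝ, 0 < η₀ ∧ ∀ η η' : ℝ, 0 < η' → η' ≤ η → η ≤ η₀ →
      Literature.MathematicalPhysics.QuantumManyBody.BoseGas.HasGroundStateBEC
        (Set.indicator (Set.Iic 1) (fun _ : ℝ => (⊤ : ENNReal))) η →
      Literature.MathematicalPhysics.QuantumManyBody.BoseGas.HasGroundStateBEC
        (Set.indicator (Set.Iic 1) (fun _ : ℝ => (⊤ : ENNReal))) η' := by
  obtain ⟨ρ₀, hρ₀, hbec⟩ := h 1 one_pos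
  refine ⟨ρ₀ / 2, half_pos hρ₀, fun η η' hη' hle hη₀le _ => ?_⟩
  exact hbec η' hη' (by linarith [half_lt_self hρ₀])

end Summit.AtomisticToContinuum.BoseEinsteinCondensation.Cruxes.HardSphereBEC

end
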